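import Literature.Barriers.Parity.LeastPrimeValueBinomialsProofs
import Literature.NumberTheory.Sieve.ShiftedPrimeDivisors
import Literature.NumberTheory.Sieve.PrimesInAPGallagherRange
import Literature.NumberTheory.Sieve.PrimesInAPGallagherRangeHolds
import HarnessLib

/-!
# McCurley 1984 (= McCurley 1986, Theorem 1) conditional on Gallagher's prime number theorem

Fourth companion ("Proofs") file of `Literature/Barriers/Parity/LeastPrimeValue.lean`, for the
named fact `Literature.Barriers.Parity.McCurley1984_binomials` (infinitely many irreducible
`xⁿ + a` composite at all `|x| < exp(exp(c log L/log log L))`).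

* `LeastPrimeValueBinomialsProofs.lean` proves McCurley's deduction from the
  Adleman–Pomerance–Rumely lemma (integers with `exp(C log n/log log n)` divisors `p − 1`):
  `McCurley1984_binomials_of_shiftedPrimeDivisors`;
* `Literature/NumberTheory/Sieve/ShiftedPrimeDivisors.lean` proves that lemma
  (Adleman–Pomerance–Rumely 1983, Proposition 10) from a prime number theorem for the progressions
  `1 (mod d)`, `d ≤ N^δ` off one exceptional modulus (hypothesis (H) there):
  `Literature.NumberTheory.Sieve.ShiftedPrimeDivisors.infinite_setOf_exp_le_card_shiftedPrimeDivisors`;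
* `Literature/NumberTheory/Sieve/PrimesInAPGallagherRange.lean` proves (H) from the tree's named
  fact `Literature.NumberTheory.Sieve.MontgomeryVaughan1975.lemma43_gallagher` (Montgomery–Vaughan
  1975, Lemma 4.3 = Gallagher 1970, Theorem 7):
  `Literature.NumberTheory.Sieve.PrimesInAPGallagher.primesInAP_lowerBound_of_lemma43_gallagher`.

This file assembles the three: `AdlemanPomeranceRumely1983_prop10_of_lemma43_gallagher` and
`McCurley1984_binomials_of_lemma43_gallagher`. Hence `McCurley1984_binomials` rests on exactly
`lemma43_gallagher`, which the tree in turn reduces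
(`Literature.NumberTheory.Sieve.MontgomeryVaughan1975.lemma43_gallagher_of_explicitFormula_of_density`)
to the truncated explicit formulae (proved) and the log-free zero-density estimate with the
Deuring–Heilbronn factor (Bombieri, *Le grand crible*, Théorème 14; not yet proved in the tree);
the discharge `McCurley1984_binomials_holds` is the one-line application once `lemma43_gallagher`
is proved. No named fact is introduced here.

UPDATE (appended): the Deuring–Heilbronn input turned out to be unnecessary for McCurley's theorem —
only the characters mod `d` with `r̃ ∤ d` are ever used, none of which is exceptional — and the
first part of Bombieri's Théorème 14 is now a theorem of the tree
(`Literature.NumberTheory.LFunctions.LogFreeDensity.logFreeDensity_dirichlet`, `…_zeta`). The chain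
`Literature.NumberTheory.Sieve.MontgomeryVaughan1975.gallagher_nonexceptional` (DH-free Gallagher) →
`Literature.NumberTheory.Sieve.PrimesInAPGallagher.primesInAP_lowerBound` →
`Literature.NumberTheory.Sieve.AdlemanPomeranceRumely1983_prop10` is unconditional, and this file
now DISCHARGES the named fact: `McCurley1984_binomials_holds`.

## References

* K. S. McCurley, Bull. AMS 11 (1984) 155–158 [McCurley1984PrimeValues]; Can. J. Math. 38 (1986),
  Theorem 1 [McCurley1986SmallestPrimeValue].
* L. M. Adleman, C. Pomerance, R. S. Rumely, Ann. of Math. 117 (1983) 173–206, Proposition 10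
  [AdlemanPomeranceRumely1983].
* H. L. Montgomery, R. C. Vaughan, Acta Arith. 27 (1975) 353–370, Lemma 4.3
  [MontgomeryVaughanActa1975]; P. X. Gallagher, Invent. Math. 11 (1970), Theorem 7 [Gallagher1970].
-/

noncomputable section

namespace Literature.Barriers.Parity

/-- **Adleman–Pomerance–Rumely 1983, Proposition 10, conditional on Gallagher's theorem** (the
tree's named fact `Literature.NumberTheory.Sieve.MontgomeryVaughan1975.lemma43_gallagher`,
Montgomery–Vaughan 1975 Lemma 4.3 = Gallagher 1970 Theorem 7): there is an absolute `C > 0` such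
that infinitely many `n` have at least `exp(C log n/log log n)` divisors `d` with `d + 1` prime
("the lemma due to A. Odlyzko" of McCurley 1986, p. 926). Composition of
`PrimesInAPGallagher.primesInAP_lowerBound_of_lemma43_gallagher` and
`ShiftedPrimeDivisors.infinite_setOf_exp_le_card_shiftedPrimeDivisors`.
[cite: AdlemanPomeranceRumely1983, Proposition 10] -/
theorem AdlemanPomeranceRumely1983_prop10_of_lemma43_gallagher
    (h43 : Literature.NumberTheory.Sieve.MontgomeryVaughan1975.lemma43_gallagher) :
    ∃ C : ℝ, 0 < C ∧ {n : ℕ | Real.exp (C * Real.log n / Real.log (Real.log n)) ≤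
      ((n.divisors.filter fun d => (d + 1).Prime).card : ℝ)}.Infinite :=
  Literature.NumberTheory.Sieve.ShiftedPrimeDivisors.infinite_setOf_exp_le_card_shiftedPrimeDivisors
    (Literature.NumberTheory.Sieve.PrimesInAPGallagher.primesInAP_lowerBound_of_lemma43_gallagher h43)

/-- **McCurley 1984 (= McCurley 1986, Theorem 1), conditional on Gallagher's prime number
theorem** (the tree's named fact `Literature.NumberTheory.Sieve.MontgomeryVaughan1975.lemma43_gallagher`):
there is `c > 0` and infinitely many irreducible `xⁿ + a` composite at all integers
`|x| < exp(exp(c log L/log log L))`, `L = L(xⁿ + a)`. McCurley's deduction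
(`McCurley1984_binomials_of_shiftedPrimeDivisors`) applied to
`AdlemanPomeranceRumely1983_prop10_of_lemma43_gallagher`.
[cite: McCurley1984PrimeValues, Theorem (as restated in McCurley 1986, Theorem 1, and Zbl 0543.10033)]
[cite: McCurley1986SmallestPrimeValue, Theorem 1 and §1 (pp. 926–927)]
[cite: AdlemanPomeranceRumely1983, Proposition 10] -/
theorem McCurley1984_binomials_of_lemma43_gallagher
    (h43 : Literature.NumberTheory.Sieve.MontgomeryVaughan1975.lemma43_gallagher) :
    McCurley1984_binomials := by
  obtain ⟨C, hC, hinf⟩ := AdlemanPomeranceRumely1983_prop10_of_lemma43_gallagher h43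
  exact McCurley1984_binomials_of_shiftedPrimeDivisors hC hinf

/-- **McCurley 1984 (= McCurley 1986, Theorem 1) — the DISCHARGE of the named fact
`Literature.Barriers.Parity.McCurley1984_binomials`**: there is an absolute `c > 0` and infinitely
many irreducible `f = xⁿ + a` such that `|f(x)|` is composite for all integers
`|x| < exp(exp(c log L(f)/log log L(f)))`. McCurley's deduction
(`McCurley1984_binomials_of_shiftedPrimeDivisors`: CRT, Eisenstein, Fermat) applied to
Adleman–Pomerance–Rumely's Proposition 10, now a theorem of the tree
(`Literature.NumberTheory.Sieve.AdlemanPomeranceRumely1983_prop10`: Gallagher's prime number theorem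
over the non-exceptional characters, from the explicit formulae and Bombieri's log-free
zero-density theorem, and the APR counting argument). Unconditional.
[cite: McCurley1984PrimeValues, Theorem (as restated in McCurley 1986, Theorem 1, and Zbl 0543.10033)]
[cite: McCurley1986SmallestPrimeValue, Theorem 1 and §1 (pp. 926–927)]
[cite: AdlemanPomeranceRumely1983, Proposition 10] -/
theorem McCurley1984_binomials_holds : McCurley1984_binomials := by
  obtain ⟨C, hC, hinf⟩ := Literature.NumberTheory.Sieve.AdlemanPomeranceRumely1983_prop10
  exact McCurley1984_binomials_of_shiftedPrimeDivisors hC hinf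

end Literature.Barriers.Parity
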